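import Summits.AtomisticToContinuum.Crystallization.Theorems.FreeSplittingCertificatesStrictSplittingRuleP1CertificatesExact
import Summits.AtomisticToContinuum.Crystallization.Theorems.FreeSplittingCertificatesStrictSplittingRuleP1ExactFlux

/-!
# `StrictSplittingRule` (stmt-AtomisticToContinuum-12560): THE CELL'S ENDPOINT, REPAIRED AND REDUCED — exact defect in (B), exact collar flux in (NC⁺), no circumradii, no flux enclosure (P1 interpolant object, part 73)

Route `FreeSplittingCertificates`, crux r3 `StrictSplittingRule` (H12⋆ = `stub_coreJointCoercive`), unit b2b-freesplit-B gen 34.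
VALUE = the statement the generated-data step (G9b) should instantiate, superseding parts 64 and 67: **`coreJointCoercive_cell_of_certificates₃`** —
`CoreJointCoercive a h (1/3) (1/12)` on the `HcpFamilyMin` box, with the cell's constants (`κ = 193/125`, `(R₁,R₂) = (81/20·a, 27/5·a)`, `Y₁ = p1Stencil`,
`β = p1Beta a h`, first shell / column sums / collar box discharged as in part 64), from the near tables `(M₁, N, M, QT)`, the far-share data of rule v31
(`w, θ, sv, o, S, wv, θv`), the legs `LEG`, the free tables `QB/L/U`, `PAYM`, and FIVE certificate-tier statements:
  (B)   per cell `T` and `3 × 3` matrix `G`: dyad readout load + κ·(EXACT radial vertex-quadrature defect `p1CellDefectG`)(G) ≤ κ(5/2)(1/24)|G|²_F ∫_Tχ²|x−y_p|⁻⁶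
        — the form `cellval.py` certifies (it bounds the exact defect per cell by the smaller of the circumradius and `|T|/16` majorants; HOME CERT §31, §34);
  (S), (TAB), (PAY) as in part 64;
  (NC⁺) `0 ≤ p1NearForm(…, QF := ∅, Δ := 0, F₀ := 0) V − κ·p1ExactFluxSum a h p V` on the least-squares constraint set (part 67: the near certificate
        charged with the EXACT collar flux; the enclosure `F₀ ± Δ` is a device of the external verification, CERT §30, not part of the statement).
Obtained from part 72 (`coreJointCoercive_of_certificates_exact`) exactly as part 64 is obtained from part 60, with (FLX) discharged by equality through
`p1NearFlux_exact` (part 67).  Gen-34 audit (CERT §34): part 64's (B) used the circumradius majorant ONLY and was therefore NOT the certified statement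
(1 870 / 1 876 cells per parity exceed that form at `f = 5/2`); this file's (B) is.  NOT a proof of H12⋆ (five certificate-tier hypotheses, verified
outside the kernel), NOT summit progress.  [folklore]
-/

noncomputable section

open Set Function Metric MeasureTheory Filter Topology
open scoped BigOperators NNReal ENNReal Classical

namespace Summit.AtomisticToContinuum.Crystallization.Theorems.StrictSplittingRuleBirth

open Literature.MathematicalPhysics.StatisticalMechanics
open Summit.AtomisticToContinuum.Crystallization.Theorems.PalmUnimodularRigidity.LayeredLawsSelectHcp

/-- **THE CELL'S ENDPOINT, REPAIRED AND REDUCED** (exact defect, exact collar flux).  See the module docstring.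
NOT a proof of H12⋆ ((B), (S), (TAB), (PAY), (NC⁺) are hypotheses verified outside the kernel), NOT summit progress. -/
theorem coreJointCoercive_cell_of_certificates₃ {a h : ℝ} (ha : 0 < a) (hh : 0 < h) (hfam : HcpFamilyMin a h)
    (M₁ N M : Bool → (ℤ × ℤ × ℤ) → (ℤ × ℤ × ℤ) → (ℤ × ℤ × ℤ) → ℝ)
    (hMN₁ : ∀ b d s s', s ∉ p1BondOffsets ∨ s' ∉ p1BondOffsets → M₁ b d s s' = 0 ∧ N b d s s' = 0)
    {C₁ : ℝ} (hdec₁ : ∀ p q : ℤ × ℤ × ℤ, ∀ s s', |M₁ (decide (Even p.1)) (q - p) s s'| ≤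
        C₁ * ((1 + ‖hcpSite a h q - hcpSite a h p‖)⁻¹) ^ 6 ∧
      |N (decide (Even p.1)) (q - p) s s'| ≤ C₁ * ((1 + ‖hcpSite a h q - hcpSite a h p‖)⁻¹) ^ 6)
    (hM : ∀ b e s s', M b e s s' = M₁ b e s s' + (fun b e s s' => if s = s' then -((193 / 125) * (2 / 5) / a ^ 4 * p1RecTable a h (p1SplitDensity (81 / 20 * a) (27 / 5 * a)) b e s) else 0) b e s s')
    -- per representative: in-layer far shares and their allocation table
    (w : (ℤ × ℤ × ℤ) → (ℤ × ℤ × ℤ) × (ℤ × ℤ × ℤ) → ℝ) (hw : ∀ p ∈ ({(0, 0, 0), (1, 0, 0)} : Finset (ℤ × ℤ × ℤ)), ∀ e, 0 ≤ w p e)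
    (hws : ∀ p ∈ ({(0, 0, 0), (1, 0, 0)} : Finset (ℤ × ℤ × ℤ)),
      Summable fun e : (ℤ × ℤ × ℤ) × (ℤ × ℤ × ℤ) => w p e * fpSq (fun k => hcpSite a h (e.1 + e.2) k - hcpSite a h e.1 k))
    (θ : (ℤ × ℤ × ℤ) → (ℤ × ℤ × ℤ) × (ℤ × ℤ × ℤ) → (ℤ × ℤ × ℤ) × Fin 6 → ℝ) (hθ : ∀ p ∈ ({(0, 0, 0), (1, 0, 0)} : Finset (ℤ × ℤ × ℤ)), ∀ e T, 0 ≤ θ p e T)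
    (hfinE : ∀ p ∈ ({(0, 0, 0), (1, 0, 0)} : Finset (ℤ × ℤ × ℤ)), ∀ e, (Function.support (θ p e)).Finite)
    (hfinC : ∀ p ∈ ({(0, 0, 0), (1, 0, 0)} : Finset (ℤ × ℤ × ℤ)), ∀ T, (Function.support fun e => θ p e T).Finite)
    (hsum : ∀ p ∈ ({(0, 0, 0), (1, 0, 0)} : Finset (ℤ × ℤ × ℤ)), ∀ e, w p e ≠ 0 → ∑ᶠ T, θ p e T = 1)
    (hcar : ∀ p ∈ ({(0, 0, 0), (1, 0, 0)} : Finset (ℤ × ℤ × ℤ)), ∀ e T, θ p e T ≠ 0 → ∃ m m' : Fin 4, e.1 = T.1 + p1VertOff (p1Par T.1) T.2 m ∧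
      e.1 + e.2 = T.1 + p1VertOff (p1Par T.1) T.2 m')
    -- per representative: vertical far shares, routing offsets and their allocation table
    (sv : (ℤ × ℤ × ℤ) → ℤ × ℤ × ℤ) (o : (ℤ × ℤ × ℤ) → (ℤ × ℤ × ℤ) → Fin 3 → ℤ × ℤ × ℤ) (S : Finset (ℤ × ℤ × ℤ))
    (ho : ∀ p ∈ ({(0, 0, 0), (1, 0, 0)} : Finset (ℤ × ℤ × ℤ)), ∀ q i, o p q i ∈ S)
    (wv : (ℤ × ℤ × ℤ) → (ℤ × ℤ × ℤ) → ℝ) (hwv : ∀ p ∈ ({(0, 0, 0), (1, 0, 0)} : Finset (ℤ × ℤ × ℤ)), ∀ q, 0 ≤ wv p q)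
    (hwvs : ∀ p ∈ ({(0, 0, 0), (1, 0, 0)} : Finset (ℤ × ℤ × ℤ)), Summable (wv p))
    (θv : (ℤ × ℤ × ℤ) → (ℤ × ℤ × ℤ) × (ℤ × ℤ × ℤ) → (ℤ × ℤ × ℤ) × Fin 6 → ℝ) (hθv : ∀ p ∈ ({(0, 0, 0), (1, 0, 0)} : Finset (ℤ × ℤ × ℤ)), ∀ e T, 0 ≤ θv p e T)
    (hfinEv : ∀ p ∈ ({(0, 0, 0), (1, 0, 0)} : Finset (ℤ × ℤ × ℤ)), ∀ e, (Function.support (θv p e)).Finite)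
    (hfinCv : ∀ p ∈ ({(0, 0, 0), (1, 0, 0)} : Finset (ℤ × ℤ × ℤ)), ∀ T, (Function.support fun e => θv p e T).Finite)
    (hsumv : ∀ p ∈ ({(0, 0, 0), (1, 0, 0)} : Finset (ℤ × ℤ × ℤ)), ∀ e, (∑ i : Fin 3, (2 / 3) * ((if e.2 = o p e.1 i then wv p e.1 else 0) +
        (if o p (e.1 - (sv p - e.2)) i = sv p - e.2 then wv p (e.1 - (sv p - e.2)) else 0))) ≠ 0 → ∑ᶠ T, θv p e T = 1)
    (hcarv : ∀ p ∈ ({(0, 0, 0), (1, 0, 0)} : Finset (ℤ × ℤ × ℤ)), ∀ e T, θv p e T ≠ 0 → ∃ m m' : Fin 4, e.1 = T.1 + p1VertOff (p1Par T.1) T.2 m ∧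
      e.1 + e.2 = T.1 + p1VertOff (p1Par T.1) T.2 m')
    -- THE PER-CELL BUDGET (B) at each representative: dyad readout + EXACT defect form (part 68), weights re-centred at `y_p`
    (hB : ∀ p ∈ ({(0, 0, 0), (1, 0, 0)} : Finset (ℤ × ℤ × ℤ)), ∀ (T : (ℤ × ℤ × ℤ) × Fin 6) (G : Fin 3 → Fin 3 → ℝ),
      (∑ᶠ e : (ℤ × ℤ × ℤ) × (ℤ × ℤ × ℤ), θ p e T * w p e *
          fpSq (fun k => (hcpSite a h (e.1 + e.2) 0 - hcpSite a h e.1 0) * G 0 k +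
            (hcpSite a h (e.1 + e.2) 1 - hcpSite a h e.1 1) * G 1 k + (hcpSite a h (e.1 + e.2) 2 - hcpSite a h e.1 2) * G 2 k)) +
      (∑ᶠ e : (ℤ × ℤ × ℤ) × (ℤ × ℤ × ℤ), θv p e T *
          (∑ i : Fin 3, (2 / 3) * ((if e.2 = o p e.1 i then wv p e.1 else 0) +
            (if o p (e.1 - (sv p - e.2)) i = sv p - e.2 then wv p (e.1 - (sv p - e.2)) else 0))) *
          fpSq (fun k => (hcpSite a h (e.1 + e.2) 0 - hcpSite a h e.1 0) * G 0 k +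
            (hcpSite a h (e.1 + e.2) 1 - hcpSite a h e.1 1) * G 1 k + (hcpSite a h (e.1 + e.2) 2 - hcpSite a h e.1 2) * G 2 k)) +
      p1CellDefectG a h (fun y k l => (193 / 125) * ((7 * (5 / 4 : ℝ) + 3 / 4) / 4) * fpChi ((81 / 20 * a) ^ 2) ((27 / 5 * a) ^ 2) (y - fun k => hcpSite a h p k) ^ 2 *
          (fpSq (y - fun k => hcpSite a h p k))⁻¹ ^ 5 * ((y - fun k => hcpSite a h p k) k * (y - fun k => hcpSite a h p k) l)) T G ≤
      (193 / 125) * ((5 / 2 * (1 / 24 * fpSymSq G) + 5 / 2 * (1 / 24 * (fpFrob G - fpSymSq G))) *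
        ∫ y in p1RealCell a h T, fpChi ((81 / 20 * a) ^ 2) ((27 / 5 * a) ^ 2) (y - fun k => hcpSite a h p k) ^ 2 * (fpSq (y - fun k => hcpSite a h p k))⁻¹ ^ 3))
    -- (S) per-site domination off the reach set, (TAB) the hat-average tables on it
    (QB : (ℤ × ℤ × ℤ) → Finset (ℤ × ℤ × ℤ)) (L U : (ℤ × ℤ × ℤ) → (ℤ × ℤ × ℤ) → ℝ)
    (hS : ∀ p ∈ ({(0, 0, 0), (1, 0, 0)} : Finset (ℤ × ℤ × ℤ)), ∀ q : ℤ × ℤ × ℤ, q ∉ QB p → q ≠ p → ∀ z : Fin 3 → ℝ,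
      0 ≤ 1 / 2 * (ljSqDeriv (‖hcpSite a h q - hcpSite a h p‖ ^ 2) * fpSq z +
          2 * (1 / 2 * (7 * ((‖hcpSite a h q - hcpSite a h p‖ ^ 2)⁻¹) ^ 8 -
            4 * ((‖hcpSite a h q - hcpSite a h p‖ ^ 2)⁻¹) ^ 5)) * p1NRad a h p (fun _ => z) q ^ 2) +
        p1SiteBare a h (fun y k l => (193 / 125) * ((7 * (5 / 4 : ℝ) + 3 / 4) / 4) * fpChi ((81 / 20 * a) ^ 2) ((27 / 5 * a) ^ 2) (y - fun k => hcpSite a h p k) ^ 2 *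
          (fpSq (y - fun k => hcpSite a h p k))⁻¹ ^ 5 * ((y - fun k => hcpSite a h p k) k * (y - fun k => hcpSite a h p k) l)) (fun _ => z) q -
        p1SiteBare a h (fun y k l => (193 / 125) * ((3 / 4 : ℝ) / 4) * fpChi ((81 / 20 * a) ^ 2) ((27 / 5 * a) ^ 2) (y - fun k => hcpSite a h p k) ^ 2 *
          (fpSq (y - fun k => hcpSite a h p k))⁻¹ ^ 4 * (if k = l then 1 else 0)) (fun _ => z) q)
    (hTab : ∀ p ∈ ({(0, 0, 0), (1, 0, 0)} : Finset (ℤ × ℤ × ℤ)), ∀ q ∈ QB p, q ≠ p → ∀ z : Fin 3 → ℝ,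
      L p q * p1NRad a h p (fun _ => z) q ^ 2 ≤
        p1SiteBare a h (fun y k l => (193 / 125) * ((7 * (5 / 4 : ℝ) + 3 / 4) / 4) * fpChi ((81 / 20 * a) ^ 2) ((27 / 5 * a) ^ 2) (y - fun k => hcpSite a h p k) ^ 2 *
          (fpSq (y - fun k => hcpSite a h p k))⁻¹ ^ 5 * ((y - fun k => hcpSite a h p k) k * (y - fun k => hcpSite a h p k) l)) (fun _ => z) q ∧
      p1SiteBare a h (fun y k l => (193 / 125) * ((3 / 4 : ℝ) / 4) * fpChi ((81 / 20 * a) ^ 2) ((27 / 5 * a) ^ 2) (y - fun k => hcpSite a h p k) ^ 2 *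
          (fpSq (y - fun k => hcpSite a h p k))⁻¹ ^ 4 * (if k = l then 1 else 0)) (fun _ => z) q ≤ U p q * fpSq z)
    -- the near tables vanish off QT
    (QT : (ℤ × ℤ × ℤ) → Finset (ℤ × ℤ × ℤ))
    (hQT : ∀ p ∈ ({(0, 0, 0), (1, 0, 0)} : Finset (ℤ × ℤ × ℤ)), ∀ q : ℤ × ℤ × ℤ, q ∉ QT p → ∀ s s',
      M₁ (decide (Even p.1)) (q - p) s s' = 0 ∧ M₁ (decide (Even q.1)) (p - q) s s' = 0 ∧
      N (decide (Even p.1)) (q - p) s s' = 0 ∧ N (decide (Even q.1)) (p - q) s' s = 0)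
    -- the far shares take at least the full load off LEG
    (LEG : (ℤ × ℤ × ℤ) → Finset ((ℤ × ℤ × ℤ) × (ℤ × ℤ × ℤ)))
    (hwfar : ∀ p ∈ ({(0, 0, 0), (1, 0, 0)} : Finset (ℤ × ℤ × ℤ)), ∀ e : (ℤ × ℤ × ℤ) × (ℤ × ℤ × ℤ), e ∉ LEG p →
      (if e.1 ≠ p ∧ e.2 ∈ p1Stencil then 1 / 2 * p1Beta a h (decide (Even e.1.1)) (p - e.1) e.2 else 0) ≤ w p e + (if e.2 = sv p then wv p e.1 else 0))
    -- (PAY) the far table's column-sum enclosures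
    (PAYM : (ℤ × ℤ × ℤ) → (ℤ × ℤ × ℤ) → ℝ)
    (hPAY : ∀ p ∈ ({(0, 0, 0), (1, 0, 0)} : Finset (ℤ × ℤ × ℤ)), ∀ s ∈ p1BondOffsets, (193 / 125) * (2 / 5) / a ^ 4 *
      (∑' q : ℤ × ℤ × ℤ, p1RecTable a h (p1SplitDensity (81 / 20 * a) (27 / 5 * a)) (decide (Even p.1)) (q - p) s) ≤ PAYM p s)
    -- (NC⁺) THE NEAR CERTIFICATE WITH THE EXACT COLLAR FLUX on the least-squares constraint set
    (hNC : ∀ p ∈ ({(0, 0, 0), (1, 0, 0)} : Finset (ℤ × ℤ × ℤ)), ∀ V : ℤ × ℤ × ℤ → (Fin 3 → ℝ), V p = 0 →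
      (∀ Z : Fin 3 → Fin 3 → ℝ, (∀ j k, Z j k = -Z k j) →
        ∑ q ∈ (if Even p.1 then hcpStarIdx.image (fun d => d + p) else hcpStarIdx.image (fun d => p - d)), ∑ k : Fin 3, V q k * (∑ j : Fin 3, (hcpSite a h q j - hcpSite a h p j) * Z j k) = 0) →
      0 ≤ p1NearForm a h (1 / 3) (1 / 12) (193 / 125) p p1Stencil (p1Beta a h) M₁ N (w p) (sv p) (wv p) (fun s => -p1Beta a h (decide (Even p.1)) 0 s) (if Even p.1 then hcpStarIdx.image (fun d => d + p) else hcpStarIdx.image (fun d => p - d)) (QB p) (QT p) ∅ (LEG p) (L p) (U p) (PAYM p) (fun _ => 0) (fun _ _ => 0) V -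
        193 / 125 * p1ExactFluxSum a h p V) :
    CoreJointCoercive a h (1 / 3) (1 / 12)  := by
  obtain ⟨hlo, hhi⟩ := ratioBox_of_hcpFamilyMin ha hh hfam
  have hR1 : (0 : ℝ) < 81 / 20 * a := by positivity
  have hR12 : (81 / 20 * a : ℝ) < 27 / 5 * a := by linarith
  have hκ : (0 : ℝ) ≤ 193 / 125 := by norm_num
  refine coreJointCoercive_of_certificates_exact ha hh hfam p1Stencil (p1Beta a h) (p1Beta_support a h) (p1Beta_decay ha hh)
    (fun u hu p _ => p1Beta_identity ha hh hfam u hu p) M₁ N M hMN₁ hdec₁ hR1 hR12 hκ hM w hw hws θ hθ hfinE hfinC hsum hcar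
    sv o S ho wv hwv hwvs θv hθv hfinEv hfinCv hsumv hcarv hB
    (fun p => if Even p.1 then hcpStarIdx.image (fun d => d + p) else hcpStarIdx.image (fun d => p - d))
    (fun p _ q => shell_iff_mem_of_hcpFamilyMin ha hh hfam p q) QB L U hS hTab QT hQT LEG hwfar
    (fun p s => -p1Beta a h (decide (Even p.1)) 0 s) (fun p _ s hs => p1Beta_colsum ha hh hfam p s hs) PAYM hPAY
    (fun p => p1CollarBox p)
    (fun p _ i hi Wv => p1FluxQuad₀_eq_zero_of_not_mem_box ha (by linarith) (by linarith) hR1 hR12 le_rfl p i hi _ _ _ _ Wv)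
    (fun p => p1ScatterQF (p1CollarBox p)) (fun p => p1ScatterFL0 (p1ExactFluxMat a h p) (p1CollarBox p)) (fun _ _ => 0)
    (fun p _ V => le_of_eq ?_) (fun p hp V hV hmom => ?_)
  · -- (FLX) with equality: the exact collar flux IS the scattered form
    show p1ExactFluxSum a h p V = p1NearFlux (p1ScatterFL0 (p1ExactFluxMat a h p) (p1CollarBox p)) (fun _ => 0) (p1ScatterQF (p1CollarBox p)) V
    rw [p1NearFlux_exact]
  · -- (NC) from (NC⁺)
    have h0 := hNC p hp V hV hmom
    show 0 ≤ p1NearForm a h (1 / 3) (1 / 12) (193 / 125) p p1Stencil (p1Beta a h) M₁ N (w p) (sv p) (wv p)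
      (fun s => -p1Beta a h (decide (Even p.1)) 0 s) (if Even p.1 then hcpStarIdx.image (fun d => d + p) else hcpStarIdx.image (fun d => p - d))
      (QB p) (QT p) (p1ScatterQF (p1CollarBox p)) (LEG p) (L p) (U p) (PAYM p) (fun _ => 0)
      (p1ScatterFL0 (p1ExactFluxMat a h p) (p1CollarBox p)) V
    unfold p1NearForm at h0 ⊢
    rw [p1NearFlux_exact]
    rw [p1NearFlux_empty] at h0
    linarith

end Summit.AtomisticToContinuum.Crystallization.Theorems.StrictSplittingRuleBirth

end
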